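import Summits.NavierStokesRegularity.NavierStokesRegularity.Theorems.FilamentSkeletonRssSkeletonJ1RFlatOutput
import Summits.NavierStokesRegularity.NavierStokesRegularity.Theorems.FilamentSkeletonRssSkeletonJ1RLiaFrameExists
import Summits.NavierStokesRegularity.NavierStokesRegularity.Theorems.FilamentSkeletonRssSkeletonJ1RSplit
import Summits.NavierStokesRegularity.NavierStokesRegularity.Theorems.FilamentSkeletonRssNormalBlockMatchedL

/-!
# Crux `SkeletonJ1R` (stmt-NavierStokesRegularity-23610) · registered line `streamline_kantorovich_R` (v7) — THE OUTPUT SHAPE K-B′ MUST DELIVER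
# NEEDS ONLY THE SLIP-ZERO CLAUSE OF `RegularWaist`: the heart ⟨23320⟩ and the crux BY NAME from a fine switched-tangent skeleton whose switched
# slip vanishes only at the waist (clauses 1 and 3 of `RegularWaist` — unique zero of the FIELD in the box `ρ√Γ/16`, and the waist eigen/normal
# block — are IDLE in the composition)

Hand `leafhand-ns-filamentskeletonrs-1` g2 (prover), 2026-08-31, `--supports stmt-NavierStokesRegularity-23610 --as helper`.  MODEL rung, NEGATIVE side
of the NS ladder: bookkeeping about a HYPOTHETICAL filament-type blow-up skeleton; nothing here bears on Navier–Stokes regularity, which is NOT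
proved; ⟨23610⟩, ⟨23320⟩, ⟨23612⟩ stay OPEN.

WHY THIS MATTERS (diagnosis of the registered output shape `FineFixedPointL`, the conclusion of stub K-B′ `KantorovichClosingBL1`).  The landed stub D
(`…SkeletonJ1RFlatOutput.flatJ1L_of_facts`) consumes of `RegularWaist Γ ρd Rb γ α x M 1 X` ONLY its second clause `(hreg j).2.1` — the switched slip
along `X_j` vanishes only at `τ = 0`.  Its first clause asks that the switched field generated by `X` have NO zero `y ≠ X_j 0` with `‖y − x_j 0‖ ≤
ρd√Γ/16`, where `ρd` is the datum's separation LOWER bound (so it may be taken as large as the true distance between the datum lines).  At model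
level that clause is NOT achievable for all admissible data: near the waist, at distance `r` off filament `j` (core `≪ r ≪` partner distance), the
true field is the filament's swirl `(Γγ_j/2πr)·ê_φ` plus the linear background `B·z` (`B` = `½·1 − α[e₃×] +` partners' strain at the waist, trace of
its symmetric normal block `= 1 − (axial strain) ≤ −δ`); in scaled variables `z = √Γ ζ` its zeros solve `(γ_j/(2π|ζ|²))Jζ + Bζ = 0`, i.e.
`det(B_n + ωJ) = det(B_n^sym) + (ω − α⟪e₃, t_j⟫)² = 0` with `ω = γ_j/(2π|ζ|²)`; for `N = 2` the partner's strain vanishes along its own axis, so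
`B_n^sym = ½·1 + S_n` is INDEFINITE (`det < 0`) and a nondegenerate zero pair exists at `|ζ⋆|² = |γ_j|/(2π|ω⋆|)`, `ω⋆ = α⟪e₃,t_j⟩ ± √(−det B_n^sym)`
(the classical stagnation points of a line vortex in a counter-rotating strained background) — inside the box `ρd√Γ/16` as soon as
`|γ_j|/(2π|ω⋆|) < (ρd/16)²`, e.g. strong frame rotation `|α| ≲ θd⁻¹` with small `θd`, or very unequal circulations.  Hence the registered output shape
is (model-level) stronger than anything the line can prove for ALL data, while the composition never needed the extra clauses.  THIS FILE makes the
positive half kernel-visible — the composition from the SLIP-ONLY output shape — so that the planner can re-type K-B′'s conclusion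
(`RegularWaist ↦` its slip clause) without touching D, F1, F2-B, F2-d, L′ or 13-R:

* `flatJ1L_of_facts_slip`, `flatOutputL_core_slip` — stub D's bookkeeping VERBATIM (proof text of `…SkeletonJ1RFlatOutput`, lead/stub-D hand credited)
  with the hypothesis `RegularWaist …` replaced by `∀ j τ, ⟪switchedField … 1 X (X_j τ), X_j′ τ⟫ = 0 → τ = 0`;
* `slipOnly_of_regularWaist` — the registered `RegularWaist` implies the slip clause (so `FineFixedPointL` implies the slip-only shape);
* ★ `tangentSkeletonNearStraightL_of_slipFixedPoint` — the heart ⟨23320⟩ BY NAME from the SLIP-ONLY output shape (F1 landed for the frame);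
* ★ `skeletonJ1R_of_slipFixedPoint` — the crux ⟨23610⟩ BY NAME from the slip-only output shape and 13-R ⟨23612⟩ (normal block + split glue landed).
[folklore]
-/

-- `dupNamespace` off: the module name repeats `NavierStokesRegularity` by the tree's `Summits/<S>/<S>/Theorems` layout (same as every sibling file).
set_option linter.dupNamespace false

noncomputable section

namespace Summit.NavierStokesRegularity.NavierStokesRegularity.Theorems.SkeletonJ1RSlipWaistOutput

open MeasureTheory Filter Topology
open Literature.Analysis.FluidPDE Literature.Analysis.FluidPDE.Tao2016
open Summit.NavierStokesRegularity.NavierStokesRegularity.Theorems.SkeletonJ1RFrame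
open Summit.NavierStokesRegularity.NavierStokesRegularity.Theorems.SkeletonJ1RSlipTools
open Summit.NavierStokesRegularity.NavierStokesRegularity.Theorems.SkeletonJ1RFlatOutput
open Summit.NavierStokesRegularity.NavierStokesRegularity.Theorems.FilamentSkeletonRssSkeletonJ1GSplit (NearStraightJ1G StraightDatum)
open Summit.NavierStokesRegularity.NavierStokesRegularity.Theorems.FilamentSkeletonRssSkeletonJ1LSplit
  (FlatJ1L TangentSkeletonNearStraightLS route_tangentSkeletonNearStraightL_iff)
open scoped RealInnerProductSpace InnerProductSpace BigOperators

/-! ## §1 Stub D's bookkeeping with the slip-zero clause only -/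

/-- **The clause bookkeeping, slip-only form.**  `…SkeletonJ1RFlatOutput.flatJ1L_of_facts` with `RegularWaist` replaced by its second clause (the
switched slip along `X_j` vanishes only at `τ = 0`); proof text verbatim otherwise. [folklore] -/
theorem flatJ1L_of_facts_slip {N : ℕ} {Γ δd ρd Λd Rwd θd Rb Rb₁ ℓ : ℝ} {γ : Fin N → ℝ} {α : ℝ} {t : Fin N → EuclideanSpace ℝ (Fin 3)}
    {x X : Fin N → ℝ → EuclideanSpace ℝ (Fin 3)} {M : EuclideanSpace ℝ (Fin 3) → EuclideanSpace ℝ (Fin 3)}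
    (hθd : 0 < θd) (hranges : θd ≤ |α| ∧ |α| ≤ θd⁻¹ ∧ ∀ j, θd ≤ |γ j| ∧ |γ j| ≤ θd⁻¹)
    (htilt : ∀ j, |⟪t j, EuclideanSpace.single 2 1⟫_ℝ| ≤ 1 - θd) (hsΓ : 0 < Real.sqrt Γ) (hRb : 0 < Rb) (hRbRb₁ : Rb ≤ Rb₁)
    (hRbθ : Rb ≤ θd / 6)
    (hℓdef : ℓ = Rb * Real.sqrt (Γ * Real.log Γ))
    (hfine : FineClass Γ δd Λd Rb γ α x X) (htan : SwitchedTangent Γ Rb γ α M 1 X)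
    (hslip : ∀ j τ, ⟪switchedField Γ Rb γ α M 1 X (X j τ), deriv (X j) τ⟫ = 0 → τ = 0)
    (htilt' : ∀ j τ, ‖deriv (X j) τ - t j‖ ≤ 3 * Rb / 8) (hosc : ∀ j u v, ‖deriv (X j) u - deriv (X j) v‖ ≤ 3 * Rb / 4)
    (hchord : ∀ j u s, 1 / 2 * |u - s| ≤ ‖X j u - X j s‖) (hsep : ∀ j k, j ≠ k → ∀ τ σ, ρd / 4 * Real.sqrt Γ ≤ ‖X j τ - X k σ‖)
    (hW0 : ∀ j, ‖X j 0‖ ≤ (Rwd + 1) * Real.sqrt Γ) (hW0ℓ : ∀ j, ‖X j 0‖ ≤ ℓ)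
    (hfar : ∀ j τ, ℓ < ‖X j τ‖ → ⟪trueField Γ γ α X (X j τ), deriv (X j) τ⟫ ≠ 0)
    (hon : ∀ y : EuclideanSpace ℝ (Fin 3), ‖y‖ ≤ ℓ → switchedField Γ Rb γ α M 1 X y = trueField Γ γ α X y) :
    FlatJ1L N (δd / 2) (min (ρd / 4) (1 / 2)) Rb₁ (max (Λd + 1) 1) (Rwd + 1) Rb (1 / 2) (θd / 2) 1 Γ γ α X
        (fun j τ => ⟪trueField Γ γ α X (X j τ), deriv (X j) τ⟫) (fun _ => 0) (fun _ _ => 1) ∧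
      NearStraightJ1G N (max (Λd + 1) 1) Rb X (fun j τ => ⟪trueField Γ γ α X (X j τ), deriv (X j) τ⟫) (fun _ _ => 1) := by
  subst hℓdef
  have hθhalf : θd / 2 ≤ θd := by linarith
  have hθinv2 : θd⁻¹ ≤ (θd / 2)⁻¹ := by rw [inv_le_inv₀ hθd (by positivity)]; linarith
  have hcd : ∀ j, ContDiff ℝ 2 (X j) := fun j => (htan j).1
  have hun : ∀ j s, ‖deriv (X j) s‖ = 1 := fun j => (htan j).2.1
  refine ⟨?_, ⟨fun j τ σ => (hosc j τ σ).trans (by linarith), fun j τ => ((hfine j).2.2.2.2.2 τ).trans (le_max_left _ _),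
      fun j τ => inv_le_one_of_one_le₀ (le_max_right _ _)⟩⟩
  intro u v A T hu hv _hA _hT
  have hv' : ∀ y, v y = trueField Γ γ α X y := by
    intro y; rw [hv, hu]; simp only [trueField, bsField]
  refine ⟨?_, ?_, ?_, ?_, ?_, ?_, ?_, ?_, ?_, ?_, ?_, ?_, ?_, ?_⟩
  · exact abs_pos.1 (lt_of_lt_of_le hθd hranges.1)
  · exact fun j => abs_pos.1 (lt_of_lt_of_le hθd (hranges.2.2 j).1)
  · exact fun j => ⟨hcd j, (hfine j).2.2.2.1, hun j, fun τ => ((hfine j).2.2.1 τ).trans hRbRb₁, (htan j).2.2.2.2.2.2⟩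
  · intro j k hjk τ σ
    exact le_trans (mul_le_mul_of_nonneg_right (min_le_left _ _) hsΓ.le) (hsep j k hjk τ σ)
  · intro j τ σ _
    calc 1 / 2 * min (ρd / 4) (1 / 2) * Real.sqrt Γ = 1 / 2 * (min (ρd / 4) (1 / 2) * Real.sqrt Γ) := by ring
      _ ≤ 1 / 2 * |τ - σ| := by gcongr
      _ ≤ ‖X j τ - X j σ‖ := hchord j τ σ
  · intro j τ
    show 1 / 2 * |τ - 0| ≤ (Rwd + 1) * Real.sqrt Γ + ‖X j τ‖
    have h1 := hchord j τ 0
    have h2 : ‖X j τ - X j 0‖ ≤ ‖X j τ‖ + ‖X j 0‖ := norm_sub_le _ _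
    linarith [hW0 j]
  · intro j τ; rw [hv']
  · intro j τ hτ
    beta_reduce
    rw [hv', ← hon _ hτ]
    exact (htan j).2.2.1 τ
  · intro j; exact hW0 j
  · intro j
    show |⟪deriv (X j) 0, EuclideanSpace.single 2 1⟫| ≤ 1 - θd / 2
    have h1 : |⟪deriv (X j) 0 - t j, EuclideanSpace.single 2 1⟫| ≤ 3 * Rb / 8 := by
      have := abs_real_inner_le_norm (deriv (X j) 0 - t j) (EuclideanSpace.single 2 1)
      have he : ‖(EuclideanSpace.single (2 : Fin 3) (1 : ℝ))‖ = 1 := by simp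
      rw [he, mul_one] at this
      exact this.trans (htilt' j 0)
    have h2 := htilt j
    have h3 : ⟪deriv (X j) 0, EuclideanSpace.single 2 1⟫ = ⟪deriv (X j) 0 - t j, EuclideanSpace.single 2 1⟫ +
        ⟪t j, EuclideanSpace.single 2 1⟫ := by rw [← inner_add_left, sub_add_cancel]
    rw [h3]
    refine (abs_add_le _ _).trans ?_
    linarith
  · exact ⟨hθhalf.trans hranges.1, hranges.2.1.trans hθinv2, fun j => ⟨hθhalf.trans (hranges.2.2 j).1,
      (hranges.2.2 j).2.trans hθinv2⟩⟩
  · intro j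
    refine ⟨?_, ?_, (hfine j).2.2.2.2.1, le_trans (le_abs_self _) (((hfine j).2.2.2.2.2 0).trans (le_max_left _ _))⟩
    · show ⟪trueField Γ γ α X (X j 0), deriv (X j) 0⟫ = 0
      rw [← hon _ (hW0ℓ j), (htan j).2.2.2.1, inner_zero_left]
    · intro τ hw
      by_cases hτ : ‖X j τ‖ ≤ Rb * Real.sqrt (Γ * Real.log Γ)
      · have h := hslip j τ
        rw [hon _ hτ] at h
        exact h hw
      · exact absurd hw (hfar j τ (lt_of_not_ge hτ))
  · intro j
    refine ⟨differentiable_const _, fun _ => one_pos, ?_, fun _ _ => rfl⟩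
    show (1:ℝ) ≤ 1 * 1
    norm_num
  · intro j τ
    show (Rwd + 1) ^ 2 * Γ * 1 ≤ 1 * ((Rwd + 1) ^ 2 * Γ + ‖X j τ‖ ^ 2)
    nlinarith [sq_nonneg ‖X j τ‖]

/-- **Stub D's frame-currency-free core, slip-only form**: `…SkeletonJ1RFlatOutput.flatOutputL_core` with `RegularWaist` replaced by the
slip-zero clause; constants and proof text verbatim otherwise (`δ := δd/2`, `ρ := min (ρd/4) (1/2)`, `K := Rb₁`, `Λ := max (Λd+1) 1`,
`Rw := Rwd+1`, `cg := 1/2`, `θ₀ := θd/2`, `KA := 1`, `Rb₁ := min (θd/6) (min (ρd/8) 1)`, `Γ₃ := exp((Q/Rb)²+1)`). [folklore] -/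
theorem flatOutputL_core_slip :
    ∀ (N : ℕ) (δd ρd Λd Rwd θd mw : ℝ) (p t : Fin N → EuclideanSpace ℝ (Fin 3)) (γ : Fin N → ℝ) (α : ℝ) (s₀ : Fin N → ℝ),
    0 < N → 0 < δd → 0 < ρd → 0 < Rwd → 0 < θd → 0 < mw → StraightDatum N δd ρd Λd Rwd θd mw p t γ α s₀ →
    (∀ j k, j ≠ k → |⟪t j, t k⟫_ℝ| ≤ 1 - θd) →
    ∃ (δ ρ K Λ Rw cg θ₀ KA Rb₁ : ℝ), 0 < δ ∧ 0 < ρ ∧ 0 < Rw ∧ 0 < cg ∧ 0 < θ₀ ∧ 0 < Rb₁ ∧ 2 * K * ρ ≤ 1 ∧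
      ∀ lam Rb : ℝ, 0 < lam → 0 < Rb → Rb ≤ Rb₁ → ∃ Γ₃ : ℝ, ∀ Γ : ℝ, Γ₃ ≤ Γ →
        ∀ (x : Fin N → ℝ → EuclideanSpace ℝ (Fin 3)) (M : EuclideanSpace ℝ (Fin 3) → EuclideanSpace ℝ (Fin 3)),
          (∀ j, x j 0 = waistPt Γ p t s₀ j) → (∀ j τ, ‖deriv (x j) τ - t j‖ ≤ Rb / 8) →
          (∀ j k, j ≠ k → ∀ τ σ, ρd / 2 * Real.sqrt Γ ≤ ‖x j τ - x k σ‖) →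
          ∀ X : Fin N → ℝ → EuclideanSpace ℝ (Fin 3),
            FineClass Γ δd Λd Rb γ α x X → SwitchedTangent Γ Rb γ α M 1 X →
            (∀ j τ, ⟪switchedField Γ Rb γ α M 1 X (X j τ), deriv (X j) τ⟫ = 0 → τ = 0) →
            ∃ (w : Fin N → ℝ → ℝ) (c : Fin N → ℝ) (Aa : Fin N → ℝ → ℝ),
              FlatJ1L N δ ρ K Λ Rw Rb cg θ₀ KA Γ γ α X w c Aa ∧ NearStraightJ1G N Λ Rb X w Aa := by
  intro N δd ρd Λd Rwd θd mw p t γ α s₀ hN hδd hρd hRwd hθd hmw hSD hGP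
  obtain ⟨ht1, -, htilt, hranges, hwaist, -⟩ := hSD
  have hθinv : 0 < θd⁻¹ := inv_pos.2 hθd
  -- the tolerance ceiling
  set Rb₁ : ℝ := min (θd / 6) (min (ρd / 8) 1) with hRb₁
  have hRb₁pos : 0 < Rb₁ := lt_min (by positivity) (lt_min (by positivity) one_pos)
  have hρpos : 0 < min (ρd / 4) (1 / 2 : ℝ) := lt_min (by positivity) (by norm_num)
  refine ⟨δd / 2, min (ρd / 4) (1 / 2), Rb₁, max (Λd + 1) 1, Rwd + 1, 1 / 2, θd / 2, 1, Rb₁, by positivity, hρpos,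
    by positivity, by norm_num, by positivity, hRb₁pos, ?_, ?_⟩
  · have h1 : Rb₁ ≤ 1 := (min_le_right _ _).trans (min_le_right _ _)
    have h2 : min (ρd / 4) (1 / 2 : ℝ) ≤ 1 / 2 := min_le_right _ _
    nlinarith [hRb₁pos, hρpos]
  intro lam Rb hlam hRb hRbRb₁
  have hRbθ : Rb ≤ θd / 6 := hRbRb₁.trans (min_le_left _ _)
  have hRbρ : Rb ≤ ρd / 8 := hRbRb₁.trans ((min_le_right _ _).trans (min_le_left _ _))
  have hRb1 : Rb ≤ 1 := hRbRb₁.trans ((min_le_right _ _).trans (min_le_right _ _))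
  -- the uniform tangential Biot–Savart constant and the threshold
  set Cu : ℝ := N * θd⁻¹ * (4 * Rb + 32 / (Real.pi * ρd)) with hCu
  have hCu0 : 0 ≤ Cu := by positivity
  set Q : ℝ := (Rwd + 1) * (5 + 8 * θd⁻¹) + 8 * Cu + 1 with hQ
  have hQpos : 0 < Q := by positivity
  refine ⟨Real.exp ((Q / Rb) ^ 2 + 1), fun Γ hΓ => ?_⟩
  obtain ⟨hΓ1, hℓQ⟩ := threshold_ball hRb hQpos hΓ
  have hΓpos : 0 < Γ := by linarith
  have hsΓ : 0 < Real.sqrt Γ := Real.sqrt_pos.2 hΓpos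
  have hℓpos : 0 < Rb * Real.sqrt (Γ * Real.log Γ) := lt_trans (by positivity) hℓQ
  intro x M hxw hreft hrefsep X hfine htan hslip
  -- basic regularity
  have hcd : ∀ j, ContDiff ℝ 2 (X j) := fun j => (htan j).1
  have hcd1 : ∀ j, ContDiff ℝ 1 (X j) := fun j => (hcd j).of_le (by norm_num)
  have hun : ∀ j s, ‖deriv (X j) s‖ = 1 := fun j => (htan j).2.1
  have hosc : ∀ j u v, ‖deriv (X j) u - deriv (X j) v‖ ≤ 3 * Rb / 4 := fun j => fine_osc hfine hreft j
  have hε1 : 3 * Rb / 4 ≤ 1 := by linarith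
  have hchord : ∀ j u s, 1 / 2 * |u - s| ≤ ‖X j u - X j s‖ := by
    intro j u s
    have h := chord_arc_of_osc (hcd1 j) (hun j) (hosc j) u s
    have hc : (1:ℝ) / 2 ≤ 1 - (3 * Rb / 4) ^ 2 / 2 := by nlinarith
    exact le_trans (mul_le_mul_of_nonneg_right hc (abs_nonneg _)) h
  have hsep : ∀ j k, j ≠ k → ∀ τ σ, ρd / 4 * Real.sqrt Γ ≤ ‖X j τ - X k σ‖ := by
    intro j k hjk τ σ
    have h := fine_sep hfine hrefsep hjk τ σ
    have : ρd / 4 * Real.sqrt Γ ≤ (ρd / 2 - 2 * Rb) * Real.sqrt Γ := mul_le_mul_of_nonneg_right (by linarith) hsΓ.le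
    exact this.trans h
  have hW0 : ∀ j, ‖X j 0‖ ≤ (Rwd + 1) * Real.sqrt Γ := by
    intro j
    have h1 := fine_waist_norm hfine j
    have h2 : ‖x j 0‖ ≤ Rwd * Real.sqrt Γ := by
      rw [hxw j]; unfold waistPt
      rw [norm_smul, Real.norm_of_nonneg hsΓ.le, mul_comm]
      exact mul_le_mul_of_nonneg_right (hwaist j) hsΓ.le
    nlinarith [hsΓ]
  have hcurv : ∀ k s, ‖deriv (deriv (X k)) s‖ ≤ Rb / Real.sqrt Γ := fun k s => fine_curv hfine hΓpos k s
  have hγ : ∀ k, |γ k| ≤ θd⁻¹ := fun k => (hranges.2.2 k).2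
  -- the tangential Biot–Savart bound, uniform along the arms
  have hB : ∀ j τ, |⟪bsField Γ γ X (X j τ), deriv (X j) τ⟫| ≤ Cu * Real.sqrt Γ := by
    intro j τ
    have h := abs_inner_bsField_le hcd hun (κ₀ := Rb / Real.sqrt Γ) (c := 1 / 2) (d := ρd / 4 * Real.sqrt Γ) (G := θd⁻¹)
      (div_pos hRb hsΓ) hcurv (by norm_num) (by norm_num) hchord (by positivity) hsep hγ hΓpos.le j τ
    have hval : (N : ℝ) * (Γ * θd⁻¹ / (4 * Real.pi) * (2 * Real.pi * (Rb / Real.sqrt Γ) / (1 / 2) ^ 3 +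
        16 / (1 / 2 * (ρd / 4 * Real.sqrt Γ)))) = Cu * Real.sqrt Γ := by
      have hΓs : Γ = Real.sqrt Γ * Real.sqrt Γ := (Real.mul_self_sqrt hΓpos.le).symm
      rw [hCu]
      generalize hs : Real.sqrt Γ = s at hΓs ⊢
      have hs0 : s ≠ 0 := by rw [← hs]; exact hsΓ.ne'
      rw [hΓs]
      field_simp
      ring
    rw [hval] at h; exact h
  -- the waist lies in the crux ball; the far slip does not vanish
  have hQ1 : Rwd + 1 ≤ Q := by
    have : (Rwd + 1) * 1 ≤ (Rwd + 1) * (5 + 8 * θd⁻¹) :=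
      mul_le_mul_of_nonneg_left (by linarith) (by linarith)
    linarith
  have hW0ℓ : ∀ j, ‖X j 0‖ ≤ Rb * Real.sqrt (Γ * Real.log Γ) := fun j =>
    (hW0 j).trans ((mul_le_mul_of_nonneg_right hQ1 hsΓ.le).trans hℓQ.le)
  have hαε : |α| * (3 * Rb / 4) ≤ 1 / 8 := by
    calc |α| * (3 * Rb / 4) ≤ θd⁻¹ * (3 * (θd / 6) / 4) := by gcongr; exact hranges.2.1
      _ = 1 / 8 := by field_simp; ring
  have hfar : ∀ j τ, Rb * Real.sqrt (Γ * Real.log Γ) < ‖X j τ‖ → ⟪trueField Γ γ α X (X j τ), deriv (X j) τ⟫ ≠ 0 := by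
    intro j τ hτ
    refine trueSlip_ne_zero_of_far (hcd1 j) (hun j) (hosc j) hε1 hαε (hB j) ?_ hτ
    have e1 : ‖X j 0‖ * (5 + 8 * |α|) ≤ (Rwd + 1) * Real.sqrt Γ * (5 + 8 * θd⁻¹) :=
      mul_le_mul (hW0 j) (by linarith [hranges.2.1]) (by positivity) (by positivity)
    calc ‖X j 0‖ + 8 * ((1 / 2 + |α|) * ‖X j 0‖ + Cu * Real.sqrt Γ) = ‖X j 0‖ * (5 + 8 * |α|) + 8 * Cu * Real.sqrt Γ := by ring
      _ ≤ (Rwd + 1) * Real.sqrt Γ * (5 + 8 * θd⁻¹) + 8 * Cu * Real.sqrt Γ := by linarith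
      _ = (Q - 1) * Real.sqrt Γ := by rw [hQ]; ring
      _ < Q * Real.sqrt Γ := by nlinarith
      _ < Rb * Real.sqrt (Γ * Real.log Γ) := hℓQ
  -- on the crux ball the switched field is the true field
  have hon : ∀ y : EuclideanSpace ℝ (Fin 3), ‖y‖ ≤ Rb * Real.sqrt (Γ * Real.log Γ) →
      switchedField Γ Rb γ α M 1 X y = trueField Γ γ α X y := by
    intro y hy
    have hw : switchWeight (Rb * Real.sqrt (Γ * Real.log Γ)) 1 y = 1 :=
      switchWeight_eq_one_of_sq_le hℓpos.ne' (by
        rw [show (2:ℝ) * 1 - 1 = 1 by norm_num, one_mul]; exact pow_le_pow_left₀ (norm_nonneg y) hy 2)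
    simp [switchedField, hw]
  exact ⟨_, _, _, flatJ1L_of_facts_slip hθd hranges htilt hsΓ hRb hRbRb₁ hRbθ rfl hfine htan hslip (fine_tilt hfine hreft) hosc hchord
    hsep hW0 hW0ℓ hfar hon⟩

/-! ## §2 The heart and the crux from the SLIP-ONLY output shape -/

/-- The registered `RegularWaist` implies the slip-zero clause (projection to its second conjunct): so the registered output shape
`FineFixedPointL` implies the slip-only shape below. [folklore] -/
theorem slipOnly_of_regularWaist {N : ℕ} {Γ ρ Rb : ℝ} {γ : Fin N → ℝ} {α : ℝ} {x : Fin N → ℝ → EuclideanSpace ℝ (Fin 3)}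
    {M : EuclideanSpace ℝ (Fin 3) → EuclideanSpace ℝ (Fin 3)} {s : ℝ} {X : Fin N → ℝ → EuclideanSpace ℝ (Fin 3)}
    (hreg : RegularWaist Γ ρ Rb γ α x M s X) :
    ∀ j τ, ⟪switchedField Γ Rb γ α M s X (X j τ), deriv (X j) τ⟫ = 0 → τ = 0 :=
  fun j τ h => (hreg j).2.1 τ h

/-- ★ **The heart ⟨stmt-NavierStokesRegularity-23320⟩ `TangentSkeletonNearStraightL` BY NAME from the SLIP-ONLY output shape**: in every LIA
frame at `λ = 1` (F1 `stub_liaFrameExistsL`, landed), for all large `Γ`, a FINE switched-tangent skeleton whose switched slip vanishes only at the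
waist EXISTS ⟹ the heart.  (The registered output shape `FineFixedPointL` asks in addition for `RegularWaist` clauses 1 and 3, which the
composition does not use.) [folklore] -/
theorem tangentSkeletonNearStraightL_of_slipFixedPoint
    (hFP : ∀ (N : ℕ) (δd ρd Λd Rwd θd mw : ℝ) (p t : Fin N → EuclideanSpace ℝ (Fin 3)) (γ : Fin N → ℝ) (α : ℝ) (s₀ : Fin N → ℝ),
      0 < N → 0 < δd → 0 < ρd → 0 < Rwd → 0 < θd → 0 < mw → StraightDatum N δd ρd Λd Rwd θd mw p t γ α s₀ →
      (∀ j k, j ≠ k → |⟪t j, t k⟫_ℝ| ≤ 1 - θd) →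
      ∃ Rb₁ : ℝ, 0 < Rb₁ ∧ ∀ Rb : ℝ, 0 < Rb → Rb ≤ Rb₁ → ∃ Γ₂ : ℝ, ∀ Γ : ℝ, Γ₂ ≤ Γ →
        ∀ (x : Fin N → ℝ → EuclideanSpace ℝ (Fin 3)) (M : EuclideanSpace ℝ (Fin 3) → EuclideanSpace ℝ (Fin 3)),
          IsLiaReference Γ Rb p t γ α s₀ x → SlicedFrame Γ ρd 1 Rb p t s₀ x M →
          ∃ X : Fin N → ℝ → EuclideanSpace ℝ (Fin 3),
            FineClass Γ δd Λd Rb γ α x X ∧ SwitchedTangent Γ Rb γ α M 1 X ∧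
              ∀ j τ, ⟪switchedField Γ Rb γ α M 1 X (X j τ), deriv (X j) τ⟫ = 0 → τ = 0) :
    Summit.NavierStokesRegularity.NavierStokesRegularity.Theses.FilamentSkeletonRss.TangentSkeletonNearStraightL := by
  refine route_tangentSkeletonNearStraightL_iff.mpr ?_
  intro N δd ρd Λd Rwd θd mw p t γ α s₀ hN hδ hρ hRw hθ hmw hSD hGP
  obtain ⟨δ, ρ, K, Λ, Rw, cg, θ₀, KA, RbD, hδ', hρ', hRw', hcg, hθ₀', hRbD, hKρ, hDfam⟩ :=
    flatOutputL_core_slip N δd ρd Λd Rwd θd mw p t γ α s₀ hN hδ hρ hRw hθ hmw hSD hGP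
  obtain ⟨RbF, hRbF, hFfam⟩ := stub_liaFrameExistsL N δd ρd Λd Rwd θd mw p t γ α s₀ hN hδ hρ hRw hθ hmw hSD hGP
  obtain ⟨RbK, hRbK, hKfam⟩ := hFP N δd ρd Λd Rwd θd mw p t γ α s₀ hN hδ hρ hRw hθ hmw hSD hGP
  refine ⟨δ, ρ, K, Λ, Rw, cg, θ₀, KA, min RbD (min RbF RbK), hδ', hρ', hRw', hcg, hθ₀',
    lt_min hRbD (lt_min hRbF hRbK), hKρ, ?_⟩
  intro Rb hRb hRb₁
  have hRbD' : Rb ≤ RbD := le_trans hRb₁ (min_le_left _ _)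
  have hRbF' : Rb ≤ RbF := le_trans hRb₁ (le_trans (min_le_right _ _) (min_le_left _ _))
  have hRbK' : Rb ≤ RbK := le_trans hRb₁ (le_trans (min_le_right _ _) (min_le_right _ _))
  obtain ⟨Γ₁, hframe⟩ := hFfam Rb hRb hRbF'
  obtain ⟨Γ₂, hfix⟩ := hKfam Rb hRb hRbK'
  obtain ⟨Γ₃, hout⟩ := hDfam 1 Rb one_pos hRb hRbD'
  refine ⟨max Γ₁ (max Γ₂ Γ₃), fun Γ hΓ => ?_⟩
  have hΓ₁ : Γ₁ ≤ Γ := le_trans (le_max_left _ _) hΓ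
  have hΓ₂ : Γ₂ ≤ Γ := le_trans (le_trans (le_max_left _ _) (le_max_right _ _)) hΓ
  have hΓ₃ : Γ₃ ≤ Γ := le_trans (le_trans (le_max_right _ _) (le_max_right _ _)) hΓ
  obtain ⟨x, M, hx, hxM⟩ := hframe Γ hΓ₁
  obtain ⟨X, hfine, htan, hslip⟩ := hfix Γ hΓ₂ x M hx hxM
  obtain ⟨w, c, Aa, hflat, hns⟩ := hout Γ hΓ₃ x M (fun j => (hxM.1.1 j).2.2) hxM.1.2.1 hxM.1.2.2.2 X hfine htan hslip
  exact ⟨X, w, c, Aa, hflat, hns⟩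

/-- ★ **The crux ⟨stmt-NavierStokesRegularity-23610⟩ `SkeletonJ1R` BY NAME from the SLIP-ONLY output shape and the 13-R item ⟨23612⟩**
(normal block ⟨23322⟩ `stub_normalBlockL` landed, split glue `skeletonJ1R_of_children` landed). [folklore] -/
theorem skeletonJ1R_of_slipFixedPoint
    (hFP : ∀ (N : ℕ) (δd ρd Λd Rwd θd mw : ℝ) (p t : Fin N → EuclideanSpace ℝ (Fin 3)) (γ : Fin N → ℝ) (α : ℝ) (s₀ : Fin N → ℝ),
      0 < N → 0 < δd → 0 < ρd → 0 < Rwd → 0 < θd → 0 < mw → StraightDatum N δd ρd Λd Rwd θd mw p t γ α s₀ →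
      (∀ j k, j ≠ k → |⟪t j, t k⟫_ℝ| ≤ 1 - θd) →
      ∃ Rb₁ : ℝ, 0 < Rb₁ ∧ ∀ Rb : ℝ, 0 < Rb → Rb ≤ Rb₁ → ∃ Γ₂ : ℝ, ∀ Γ : ℝ, Γ₂ ≤ Γ →
        ∀ (x : Fin N → ℝ → EuclideanSpace ℝ (Fin 3)) (M : EuclideanSpace ℝ (Fin 3) → EuclideanSpace ℝ (Fin 3)),
          IsLiaReference Γ Rb p t γ α s₀ x → SlicedFrame Γ ρd 1 Rb p t s₀ x M →
          ∃ X : Fin N → ℝ → EuclideanSpace ℝ (Fin 3),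
            FineClass Γ δd Λd Rb γ α x X ∧ SwitchedTangent Γ Rb γ α M 1 X ∧
              ∀ j τ, ⟪switchedField Γ Rb γ α M 1 X (X j τ), deriv (X j) τ⟫ = 0 → τ = 0)
    (h13R : Summit.NavierStokesRegularity.NavierStokesRegularity.Theses.FilamentSkeletonRss.Clause13RNearStraightL) :
    Summit.NavierStokesRegularity.NavierStokesRegularity.Theses.FilamentSkeletonRss.SkeletonJ1R :=
  Summit.NavierStokesRegularity.NavierStokesRegularity.Theorems.FilamentSkeletonRssSkeletonJ1RSplit.skeletonJ1R_of_children
    (tangentSkeletonNearStraightL_of_slipFixedPoint hFP) h13R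
    Summit.NavierStokesRegularity.NavierStokesRegularity.Theorems.FilamentSkeletonRssNormalBlockMatchedL.stub_normalBlockL

end Summit.NavierStokesRegularity.NavierStokesRegularity.Theorems.SkeletonJ1RSlipWaistOutput

end
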